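import Summits.CriticalPhenomena.PercolationContinuityZ3.Theorems.PercNearOneGluingNoHeavyLowerTailStarSetClassBalanced
import Summits.CriticalPhenomena.PercolationContinuityZ3.Theorems.PercNearOneGluingNoHeavyLowerTailStarSetClassOdds
import Summits.CriticalPhenomena.PercolationContinuityZ3.Theorems.PercNearOneGluingNoHeavyLowerTailStarSetClassWordsBound
import Summits.CriticalPhenomena.PercolationContinuityZ3.Theorems.PercNearOneGluingNoHeavyLowerTailStarSetClassWordsMulti
import Summits.CriticalPhenomena.PercolationContinuityZ3.Theorems.PercNearOneGluingNoHeavyLowerTailStarSetHairAMGM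
import Summits.CriticalPhenomena.PercolationContinuityZ3.Theorems.PercNearOneGluingNoHeavyLowerTailStarSetSupplyGlue
import HarnessLib

/-!
# `NoHeavyLowerTail` (stmt-CriticalPhenomena-4575) — class-level data of a two-port star system: odds, Φ, and the class-word mass (blueprint §A/§B)

Support file (prover `prim-gen-swap` gen 13; `--supports stmt-CriticalPhenomena-4575`).  No definitions, no named facts, no sorries.

The analytic hypotheses of the class-level charging theorem (`hO0, hO1, hO2, hΦ4, hΦsq` of LEAN-BLUEPRINT-U1.md §B /
ChargingTargets.TARGET) hold for the class odds `O_k = Π_{i∈X}(a_i(0)+a_i(k))/Π_{i∈X} a_i(0) − 1` and `Φ_X = Σ_{i∈X} √θ_i/(1−√θ_i)` of a class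
`X` of stars with extreme coefficients `a_i(k)` (abstractly: `a0 > 0`, `a1, a2 ≥ 0`, `θ ∈ [0,1]` with `θ < 1` on `X`, the one-star bounds L1.1 `a0 ≤ (1−θ)(a0+a_k)`
and AM–GM `a0²θ ≤ a1a2(1−√θ)²`), and the mass of a class-word is `C0·Π_{X∈T} O_X(δ X)`.

* `StarSet.phi_ge_four_mul`, `StarSet.sqrt_le_phi` — `4θ ≤ φ(θ)` and `√θ ≤ φ(θ)` for `θ ∈ [0,1)`;
* `StarSet.classData_hypotheses` — the seven facts `0 ≤ O₁, O₂`, `Θ ≤ (1−Θ)O_k`, `Φ² ≤ O₁O₂`, `4Θ ≤ Φ`, `Θ ≤ Φ²` for `Θ = 1 − Π(1−θ_i)`;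
* `StarSet.classWord_mass_eq` — `Σ_{e ∈ Pat(T,k)} Π_i c_i(e_i) = (Π_i c_i 0)·Π_{X∈T} (Π_{X}(c0+c_k)/Π_X c0 − 1)` (`c_i(0) ≠ 0`).
-/

namespace Summit.CriticalPhenomena.PercolationContinuityZ3.Theorems

open Finset
open scoped BigOperators

namespace StarSet

/-- `4θ ≤ φ(θ) = √θ/(1−√θ)` for `θ ∈ [0,1)`. -/
theorem phi_ge_four_mul (θ : ℝ) (hθ0 : 0 ≤ θ) (hθ1 : θ < 1) : 4 * θ ≤ Real.sqrt θ / (1 - Real.sqrt θ) := by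
  have hs1 : Real.sqrt θ < 1 := by
    rw [show (1 : ℝ) = Real.sqrt 1 by simp]
    exact Real.sqrt_lt_sqrt hθ0 hθ1
  have hpos : 0 < 1 - Real.sqrt θ := by linarith
  rw [le_div_iff₀ hpos]
  have h4 := four_sqrt_mul_le θ
  have hsq : Real.sqrt θ ^ 2 = θ := Real.sq_sqrt hθ0
  nlinarith [Real.sqrt_nonneg θ]

/-- `√θ ≤ φ(θ)` for `θ ∈ [0,1)`. -/
theorem sqrt_le_phi (θ : ℝ) (hθ0 : 0 ≤ θ) (hθ1 : θ < 1) : Real.sqrt θ ≤ Real.sqrt θ / (1 - Real.sqrt θ) := by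
  have hs1 : Real.sqrt θ < 1 := by
    rw [show (1 : ℝ) = Real.sqrt 1 by simp]
    exact Real.sqrt_lt_sqrt hθ0 hθ1
  have hpos : 0 < 1 - Real.sqrt θ := by linarith
  rw [le_div_iff₀ hpos]
  nlinarith [Real.sqrt_nonneg θ]

/-- **Class-level analytic data (LEAN-BLUEPRINT-U1 §B).**  For a class `X` of stars with `a0 > 0`, `a1, a2 ≥ 0`, `θ ∈ [0,1)`, the one-star
bounds `a0 ≤ (1−θ)(a0 + a_k)` and `a0²θ ≤ a1a2(1−√θ)²`: with `Θ = 1 − Π(1−θ)`, `O_k = Π(a0+a_k)/Π a0 − 1`, `Φ = Σ √θ/(1−√θ)`, the facts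
`0 ≤ O₁`, `0 ≤ O₂`, `Θ ≤ (1−Θ)O₁`, `Θ ≤ (1−Θ)O₂`, `Φ² ≤ O₁O₂`, `4Θ ≤ Φ`, `Θ ≤ Φ²`. -/
theorem classData_hypotheses {ι : Type*} [DecidableEq ι] (X : Finset ι) (a0 a1 a2 θ : ι → ℝ)
    (h0 : ∀ i ∈ X, 0 < a0 i) (h1 : ∀ i ∈ X, 0 ≤ a1 i) (h2 : ∀ i ∈ X, 0 ≤ a2 i)
    (hθ0 : ∀ i, 0 ≤ θ i) (hθle : ∀ i, θ i ≤ 1) (hθ1 : ∀ i ∈ X, θ i < 1)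
    (hstar1 : ∀ i ∈ X, a0 i ≤ (1 - θ i) * (a0 i + a1 i)) (hstar2 : ∀ i ∈ X, a0 i ≤ (1 - θ i) * (a0 i + a2 i))
    (hgm : ∀ i ∈ X, a0 i ^ 2 * θ i ≤ a1 i * a2 i * (1 - Real.sqrt (θ i)) ^ 2) :
    0 ≤ (∏ i ∈ X, (a0 i + a1 i)) / (∏ i ∈ X, a0 i) - 1 ∧
    0 ≤ (∏ i ∈ X, (a0 i + a2 i)) / (∏ i ∈ X, a0 i) - 1 ∧
    (1 - ∏ i ∈ X, (1 - θ i)) ≤ (1 - (1 - ∏ i ∈ X, (1 - θ i))) * ((∏ i ∈ X, (a0 i + a1 i)) / (∏ i ∈ X, a0 i) - 1) ∧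
    (1 - ∏ i ∈ X, (1 - θ i)) ≤ (1 - (1 - ∏ i ∈ X, (1 - θ i))) * ((∏ i ∈ X, (a0 i + a2 i)) / (∏ i ∈ X, a0 i) - 1) ∧
    (∑ i ∈ X, Real.sqrt (θ i) / (1 - Real.sqrt (θ i))) ^ 2 ≤
      ((∏ i ∈ X, (a0 i + a1 i)) / (∏ i ∈ X, a0 i) - 1) * ((∏ i ∈ X, (a0 i + a2 i)) / (∏ i ∈ X, a0 i) - 1) ∧
    4 * (1 - ∏ i ∈ X, (1 - θ i)) ≤ ∑ i ∈ X, Real.sqrt (θ i) / (1 - Real.sqrt (θ i)) ∧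
    (1 - ∏ i ∈ X, (1 - θ i)) ≤ (∑ i ∈ X, Real.sqrt (θ i) / (1 - Real.sqrt (θ i))) ^ 2 := by
  have hP0 : 0 < ∏ i ∈ X, a0 i := prod_pos h0
  have hP0ne : (∏ i ∈ X, a0 i) ≠ 0 := ne_of_gt hP0
  -- products with an extra nonnegative summand dominate
  have hge1 : ∏ i ∈ X, a0 i ≤ ∏ i ∈ X, (a0 i + a1 i) :=
    prod_le_prod (fun i hi => (h0 i hi).le) fun i hi => by linarith [h1 i hi]
  have hge2 : ∏ i ∈ X, a0 i ≤ ∏ i ∈ X, (a0 i + a2 i) :=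
    prod_le_prod (fun i hi => (h0 i hi).le) fun i hi => by linarith [h2 i hi]
  have hO1 : 0 ≤ (∏ i ∈ X, (a0 i + a1 i)) / (∏ i ∈ X, a0 i) - 1 := by
    rw [sub_nonneg, le_div_iff₀ hP0, one_mul]; exact hge1
  have hO2 : 0 ≤ (∏ i ∈ X, (a0 i + a2 i)) / (∏ i ∈ X, a0 i) - 1 := by
    rw [sub_nonneg, le_div_iff₀ hP0, one_mul]; exact hge2
  -- L1.1
  have hL1 : ∀ g : ι → ℝ, (∀ i ∈ X, a0 i ≤ (1 - θ i) * (a0 i + g i)) →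
      (1 - ∏ i ∈ X, (1 - θ i)) ≤ (1 - (1 - ∏ i ∈ X, (1 - θ i))) * ((∏ i ∈ X, (a0 i + g i)) / (∏ i ∈ X, a0 i) - 1) := by
    intro g hg
    have h := prod_coeffZero_le_classOdds X θ a0 g (fun i hi => (h0 i hi).le) hg
    rw [sub_sub_cancel]
    have : (∏ i ∈ X, (1 - θ i)) * ((∏ i ∈ X, (a0 i + g i)) / (∏ i ∈ X, a0 i) - 1) =
        ((∏ i ∈ X, (1 - θ i)) * ∏ i ∈ X, (a0 i + g i)) / (∏ i ∈ X, a0 i) - ∏ i ∈ X, (1 - θ i) := by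
      field_simp
    rw [this, le_sub_iff_add_le, le_div_iff₀ hP0]
    nlinarith
  -- L1.2
  have hL2 : (∑ i ∈ X, Real.sqrt (θ i) / (1 - Real.sqrt (θ i))) ^ 2 ≤
      ((∏ i ∈ X, (a0 i + a1 i)) / (∏ i ∈ X, a0 i) - 1) * ((∏ i ∈ X, (a0 i + a2 i)) / (∏ i ∈ X, a0 i) - 1) := by
    have h := classOdds_mul_ge_sq_sum_phi X a0 a1 a2 θ h0 h1 h2 (fun i _ => hθ0 i) hθ1 hgm
    have heq : ((∏ i ∈ X, (a0 i + a1 i)) / (∏ i ∈ X, a0 i) - 1) * ((∏ i ∈ X, (a0 i + a2 i)) / (∏ i ∈ X, a0 i) - 1) =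
        (((∏ i ∈ X, (a0 i + a1 i)) - ∏ i ∈ X, a0 i) * ((∏ i ∈ X, (a0 i + a2 i)) - ∏ i ∈ X, a0 i)) /
          (∏ i ∈ X, a0 i) ^ 2 := by
      field_simp
    rw [heq, le_div_iff₀ (pow_pos hP0 2)]
    linarith
  -- Φ bounds
  have hΘle : 1 - ∏ i ∈ X, (1 - θ i) ≤ ∑ i ∈ X, θ i := one_sub_prod_le_sum X θ hθ0 hθle
  have hΦ4 : 4 * (1 - ∏ i ∈ X, (1 - θ i)) ≤ ∑ i ∈ X, Real.sqrt (θ i) / (1 - Real.sqrt (θ i)) := by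
    have : 4 * ∑ i ∈ X, θ i ≤ ∑ i ∈ X, Real.sqrt (θ i) / (1 - Real.sqrt (θ i)) := by
      rw [mul_sum]; exact sum_le_sum fun i hi => phi_ge_four_mul (θ i) (hθ0 i) (hθ1 i hi)
    linarith
  have hΦsq : (1 - ∏ i ∈ X, (1 - θ i)) ≤ (∑ i ∈ X, Real.sqrt (θ i) / (1 - Real.sqrt (θ i))) ^ 2 := by
    have hs := sqrt_classWeight_le_sum_sqrt X θ hθ0 hθle
    have hs2 : ∑ i ∈ X, Real.sqrt (θ i) ≤ ∑ i ∈ X, Real.sqrt (θ i) / (1 - Real.sqrt (θ i)) :=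
      sum_le_sum fun i hi => sqrt_le_phi (θ i) (hθ0 i) (hθ1 i hi)
    have hnn : 0 ≤ 1 - ∏ i ∈ X, (1 - θ i) := by
      rw [sub_nonneg]
      exact prod_le_one (fun i _ => by linarith [hθle i]) fun i _ => by linarith [hθ0 i]
    calc (1 - ∏ i ∈ X, (1 - θ i)) = Real.sqrt (1 - ∏ i ∈ X, (1 - θ i)) ^ 2 := (Real.sq_sqrt hnn).symm
      _ ≤ (∑ i ∈ X, Real.sqrt (θ i) / (1 - Real.sqrt (θ i))) ^ 2 :=
          pow_le_pow_left₀ (Real.sqrt_nonneg _) (hs.trans hs2) 2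
  exact ⟨hO1, hO2, hL1 a1 hstar1, hL1 a2 hstar2, hL2, hΦ4, hΦsq⟩

/-- **Mass of a class-word = `C0 · Π_{X∈T} O_X`**: with `c_i(0) ≠ 0` for all stars,
`Σ_{e∈Pat(T,k)} Π_i c_i(e_i) = (Π_i c_i 0)·Π_{X∈T}((Π_{cls i = X}(c_i 0 + c_i(k_i)))/(Π_{cls i = X} c_i 0) − 1)`. -/
theorem classWord_mass_eq {m : ℕ} {κ : Type*} [DecidableEq κ] (cls : Fin m → κ) (k : Fin m → Fin 3) (hk : ∀ i, k i ≠ 0)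
    (T : Finset κ) (c : Fin m → Fin 3 → ℝ) (hc0 : ∀ i, c i 0 ≠ 0) :
    ∑ e ∈ (univ : Finset (Fin m → Fin 3)).filter (fun e =>
        (∀ i, cls i ∉ T → e i = 0) ∧ (∀ i, cls i ∈ T → (e i = 0 ∨ e i = k i)) ∧ (∀ X ∈ T, ∃ i, cls i = X ∧ e i ≠ 0)),
        ∏ i, c i (e i) =
      (∏ i, c i 0) * ∏ X ∈ T, ((∏ i ∈ univ.filter (fun i => cls i = X), (c i 0 + c i (k i))) /
        (∏ i ∈ univ.filter (fun i => cls i = X), c i 0) - 1) := by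
  rw [sum_patterns_classWord_eq cls k hk T c, prod_coeffZero_split_classes cls T (fun i => c i 0), mul_assoc, ← prod_mul_distrib]
  congr 1
  refine prod_congr rfl fun X _ => ?_
  have hne : (∏ i ∈ univ.filter (fun i => cls i = X), c i 0) ≠ 0 := prod_ne_zero_iff.2 fun i _ => hc0 i
  field_simp

end StarSet

end Summit.CriticalPhenomena.PercolationContinuityZ3.Theorems
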